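import Summits.QuantumFields.YangMills.Theorems.VirialFluxGapResolventFieldGeneric
import Summits.QuantumFields.YangMills.Theorems.VirialFluxGapResolventFieldCoefficients
import HarnessLib

/-!
# Route `VirialFluxGap` (YangMills): the RESOLVENT EULER FIELD — FRAME SCALING and the master estimates for frames of ANY slot norm

Toward the deciding crux `VirialFluxGap.PeriodicSoftness` (item stmt-QuantumFields-24141), generic-region Euler field `X_g = ½(H+λ⋆)⁻¹g`
(memo `fcl-p3-g40-RESOLVENT-EULER-FIELD-24141.md`).  The landed master estimates ✓`generic_drive_lower` / ✓`generic_divergence_upper`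
ask for a frame family with Frobenius slot norms `‖τ_j(w)‖ ≤ 1` (`halfPauli`/`stdFrame` has `1/√2`); the tree-gauged family `fixFrame`
of ✓`VirialFluxGapFixFrame` (w2) is built on `quatMatrix (zUnit a) ∈ SU(2)`, whose Frobenius norm is `√2`.  This file removes the
restriction ONCE AND FOR ALL by the scaling symmetry `τ ↦ B⁻¹τ`, `u ↦ Bu`, `λ⋆ ↦ λ⋆/B²`, `κ ↦ κ/B²`, `B_i ↦ B⁻³B_i`, under which the curve
`P·exp(Y_u)`, the quadratic form `½gᵀ(H+λ⋆)⁻¹g`, the trace `tr((H+λ⋆)⁻¹H)` and the correction `Σ_i((H+λ⋆)⁻¹B_i(H+λ⋆)⁻¹g)_i` are all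
INVARIANT:

* §1 scaling letters: `dirOf (B⁻¹τ) (Bu) = dirOf τ u`, `frameGrad (cτ) = c·frameGrad τ`, `frameHessRaw (cτ) = c²·frameHessRaw τ`,
  `frameHess (cτ) = c²·frameHess τ`, `(c•A)⁻¹ = c⁻¹•A⁻¹` (no invertibility hypothesis), `multiCurve` is insensitive to its proof arguments;
* §2 ★★★ `generic_drive_lower_of_norm_le` and ★★★ `generic_divergence_upper_of_norm_le`: the two master estimates VERBATIM for a frame family
  with `‖τ_j(w)‖ ≤ B` (`0 < B`), the only change being `K ↦ K·B³` in the smallness hypothesis and in the error terms (the trilinear third-derivative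
  bound `hK3` is frame-free and unchanged; the matrices `B_i` and their bound `b` are unchanged).

HONEST LABEL: corollaries by symmetry; the Euler field is NOT assembled here; ⟨24141⟩, ⟨22884⟩ remain OPEN; the Yang–Mills mass gap is
NOT proved; no summit is proved by a line.  THEOREMS ONLY (0 `def`, 0 `sorry`), standard axioms.  Explicit-unit seat `ym-line-fcl-p3` g40
(cell ym-idea-1, free hands), `--supports stmt-QuantumFields-24141`.  References: [folklore].
-/

set_option autoImplicit false

noncomputable section

open scoped Matrix BigOperators ContDiff Topology
open MeasureTheory Set Matrix
open Literature.MathematicalPhysics.QuantumFieldTheory hiding SU2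
open Literature.MathematicalPhysics.QuantumLattice
open Literature.MathematicalPhysics.QuantumFieldTheory.SUNBakryEmery (expSU coe_expSU matTop)

namespace Summit.QuantumFields.YangMills.Theorems.VirialFluxGap.FrameHessian

open Summit.QuantumFields.YangMills.Theorems.FemtoTransferGap
open Summit.QuantumFields.YangMills.Theorems.FemtoTransferGap.TT
open Summit.QuantumFields.YangMills.Theorems.VirialFluxGap.RingDeficit
open Summit.QuantumFields.YangMills.Theorems.VirialFluxGap.FrameDerivative
open Summit.QuantumFields.YangMills.Theorems.VirialFluxGap.ResolventField

variable {L : ℕ} [NeZero L]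
variable {ι : Type*} [Fintype ι]

open scoped Matrix.Norms.Frobenius

attribute [local instance 2000] Literature.MathematicalPhysics.QuantumFieldTheory.SUNBakryEmery.matTop

/-! ## §1 Scaling letters -/

omit [NeZero L] in
/-- `multiCurve` does not depend on its proof arguments: equal assignments give equal curves. [folklore] -/
theorem multiCurve_congr {Y Y' : ((Fin (2 * L - 1 + 1) × Edge 3 L) ⊕ Site 3 L) → Matrix (Fin 2) (Fin 2) ℂ} (h : Y = Y') (hY : ∀ w, (Y w)ᴴ = -Y w) (hY0 : ∀ w, (Y w).trace = 0)
    (hY' : ∀ w, (Y' w)ᴴ = -Y' w) (hY0' : ∀ w, (Y' w).trace = 0) (s : ℝ) :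
    multiCurve (L := L) Y hY hY0 s = multiCurve (L := L) Y' hY' hY0' s := by
  subst h
  rfl

omit [NeZero L] [Fintype ι] in
/-- A rescaled skew-Hermitian frame is skew-Hermitian. [folklore] -/
theorem smul_frame_conjTranspose {τ : ι → ((Fin (2 * L - 1 + 1) × Edge 3 L) ⊕ Site 3 L) → Matrix (Fin 2) (Fin 2) ℂ} (hτ : ∀ j w, (τ j w)ᴴ = -τ j w) (c : ℝ) (j : ι) (w : ((Fin (2 * L - 1 + 1) × Edge 3 L) ⊕ Site 3 L)) :
    ((c • τ j) w)ᴴ = -(c • τ j) w := by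
  rw [Pi.smul_apply, Matrix.conjTranspose_smul, star_trivial, hτ j w, smul_neg]

omit [NeZero L] [Fintype ι] in
/-- A rescaled traceless frame is traceless. [folklore] -/
theorem smul_frame_trace {τ : ι → ((Fin (2 * L - 1 + 1) × Edge 3 L) ⊕ Site 3 L) → Matrix (Fin 2) (Fin 2) ℂ} (hτ0 : ∀ j w, (τ j w).trace = 0) (c : ℝ) (j : ι) (w : ((Fin (2 * L - 1 + 1) × Edge 3 L) ⊕ Site 3 L)) :
    ((c • τ j) w).trace = 0 := by
  rw [Pi.smul_apply, Matrix.trace_smul, hτ0 j w, smul_zero]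

omit [NeZero L] [Fintype ι] in
/-- Slot norms of a rescaled frame: `‖B⁻¹τ_j(w)‖ ≤ 1` when `‖τ_j(w)‖ ≤ B`, `0 < B`. [folklore] -/
theorem norm_inv_smul_frame_le {τ : ι → ((Fin (2 * L - 1 + 1) × Edge 3 L) ⊕ Site 3 L) → Matrix (Fin 2) (Fin 2) ℂ} {B : ℝ} (hB : 0 < B) (hτn : ∀ j w, ‖τ j w‖ ≤ B) (j : ι) (w : ((Fin (2 * L - 1 + 1) × Edge 3 L) ⊕ Site 3 L)) :
    ‖(B⁻¹ • τ j) w‖ ≤ 1 := by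
  rw [Pi.smul_apply, norm_smul, Real.norm_eq_abs, abs_of_pos (inv_pos.mpr hB)]
  calc B⁻¹ * ‖τ j w‖ ≤ B⁻¹ * B := mul_le_mul_of_nonneg_left (hτn j w) (inv_pos.mpr hB).le
    _ = 1 := inv_mul_cancel₀ hB.ne'

omit [NeZero L] in
/-- The direction of a rescaled frame: `dirOf (cτ) u = dirOf τ (cu)`. [folklore] -/
theorem dirOf_smul_frame (c : ℝ) (τ : ι → ((Fin (2 * L - 1 + 1) × Edge 3 L) ⊕ Site 3 L) → Matrix (Fin 2) (Fin 2) ℂ) (u : ι → ℝ) :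
    dirOf (fun j => c • τ j) u = dirOf τ (c • u) := by
  unfold dirOf
  refine Finset.sum_congr rfl fun j _ => ?_
  rw [smul_smul, Pi.smul_apply, smul_eq_mul]
  congr 1
  exact mul_comm _ _

omit [NeZero L] in
/-- The direction is unchanged under `τ ↦ B⁻¹τ`, `u ↦ Bu`. [folklore] -/
theorem dirOf_inv_smul_frame_smul {B : ℝ} (hB : B ≠ 0) (τ : ι → ((Fin (2 * L - 1 + 1) × Edge 3 L) ⊕ Site 3 L) → Matrix (Fin 2) (Fin 2) ℂ) (u : ι → ℝ) :
    dirOf (fun j => B⁻¹ • τ j) (B • u) = dirOf τ u := by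
  rw [dirOf_smul_frame, smul_smul, inv_mul_cancel₀ hB, one_smul]

/-- The frame derivative of a constant multiple: `∂_Y(c·f) = c·∂_Y f` (for differentiable `f`). [folklore] -/
theorem frameD_const_mul (Y : ((Fin (2 * L - 1 + 1) × Edge 3 L) ⊕ Site 3 L) → Matrix (Fin 2) (Fin 2) ℂ) {f : ((Fin (2 * L - 1 + 1) → Edge 3 L → Matrix (Fin 2) (Fin 2) ℂ) × (Site 3 L → Matrix (Fin 2) (Fin 2) ℂ)) → ℝ} (hf : ContDiff ℝ ∞ f) (c : ℝ) (M : ((Fin (2 * L - 1 + 1) → Edge 3 L → Matrix (Fin 2) (Fin 2) ℂ) × (Site 3 L → Matrix (Fin 2) (Fin 2) ℂ))) :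
    frameD Y (fun M' => c * f M') M = c * frameD Y f M := by
  unfold frameD
  have hd : DifferentiableAt ℝ f M := (hf.differentiable (by simp)).differentiableAt
  have h1 : (fun M' => c * f M') = c • f := funext fun _ => rfl
  rw [h1, fderiv_const_smul hd c, _root_.smul_apply, smul_eq_mul]

omit [Fintype ι] in
/-- The frame gradient of a rescaled frame: `frameGrad (cτ) = c·frameGrad τ`. [folklore] -/
theorem frameGrad_smul_frame (c : ℝ) (τ : ι → ((Fin (2 * L - 1 + 1) × Edge 3 L) ⊕ Site 3 L) → Matrix (Fin 2) (Fin 2) ℂ) (M : ((Fin (2 * L - 1 + 1) → Edge 3 L → Matrix (Fin 2) (Fin 2) ℂ) × (Site 3 L → Matrix (Fin 2) (Fin 2) ℂ))) :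
    frameGrad (L := L) (fun j => c • τ j) M = c • frameGrad (L := L) τ M := by
  funext j
  simp only [frameGrad, Pi.smul_apply, smul_eq_mul, frameD_smul_dir]

omit [Fintype ι] in
/-- The raw frame Hessian of a rescaled frame: `frameHessRaw (cτ) = c²·frameHessRaw τ`. [folklore] -/
theorem frameHessRaw_smul_frame (c : ℝ) (τ : ι → ((Fin (2 * L - 1 + 1) × Edge 3 L) ⊕ Site 3 L) → Matrix (Fin 2) (Fin 2) ℂ) (M : ((Fin (2 * L - 1 + 1) → Edge 3 L → Matrix (Fin 2) (Fin 2) ℂ) × (Site 3 L → Matrix (Fin 2) (Fin 2) ℂ))) :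
    frameHessRaw (L := L) (fun j => c • τ j) M = (c * c) • frameHessRaw (L := L) τ M := by
  ext j k
  simp only [frameHessRaw, Matrix.smul_apply, smul_eq_mul]
  have h1 : frameD (c • τ k) (ringPoly L) = fun M' => c * frameD (τ k) (ringPoly L) M' := funext fun M' => frameD_smul_dir c (τ k) _ M'
  rw [h1, frameD_smul_dir, frameD_const_mul (τ j) (contDiff_frameD (contDiff_ringPoly (L := L)) (τ k))]
  ring

omit [Fintype ι] in
/-- The symmetrised frame Hessian of a rescaled frame: `frameHess (cτ) = c²·frameHess τ`. [folklore] -/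
theorem frameHess_smul_frame (c : ℝ) (τ : ι → ((Fin (2 * L - 1 + 1) × Edge 3 L) ⊕ Site 3 L) → Matrix (Fin 2) (Fin 2) ℂ) (M : ((Fin (2 * L - 1 + 1) → Edge 3 L → Matrix (Fin 2) (Fin 2) ℂ) × (Site 3 L → Matrix (Fin 2) (Fin 2) ℂ))) :
    frameHess (L := L) (fun j => c • τ j) M = (c * c) • frameHess (L := L) τ M := by
  ext j k
  simp only [frameHess, frameHessRaw_smul_frame, Matrix.smul_apply, smul_eq_mul]
  ring

/-- Inverse of a scalar multiple of a square matrix, WITHOUT an invertibility hypothesis: `(c•A)⁻¹ = c⁻¹•A⁻¹` for `c ≠ 0` (both sides vanish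
when `A` is singular). [folklore] -/
theorem inv_smul_of_ne_zero [DecidableEq ι] {c : ℝ} (hc : c ≠ 0) (A : Matrix ι ι ℝ) : (c • A)⁻¹ = c⁻¹ • A⁻¹ := by
  by_cases hA : IsUnit A.det
  · refine Matrix.inv_eq_left_inv ?_
    rw [Matrix.smul_mul, Matrix.mul_smul, smul_smul, Matrix.nonsing_inv_mul A hA, inv_mul_cancel₀ hc, one_smul]
  · have hcA : ¬IsUnit (c • A).det := by
      rw [Matrix.det_smul, isUnit_iff_ne_zero, mul_ne_zero_iff, not_and_or, not_not, not_not]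
      exact Or.inr (by rwa [isUnit_iff_ne_zero, not_not] at hA)
    rw [Matrix.nonsing_inv_apply_not_isUnit _ hA, Matrix.nonsing_inv_apply_not_isUnit _ hcA, smul_zero]

omit [Fintype ι] in
/-- The shifted Hessian of the rescaled frame: `c²H + (c²λ)•1 = c²•(H + λ•1)`. [folklore] -/
theorem smul_shift_eq [DecidableEq ι] (c : ℝ) (H : Matrix ι ι ℝ) (lam : ℝ) :
    (c • H + (c * lam) • (1 : Matrix ι ι ℝ)) = c • (H + lam • (1 : Matrix ι ι ℝ)) := by
  rw [smul_add, smul_smul]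

/-- ℓ¹ letter: `Σ|B u_j| = B·Σ|u_j|` for `0 < B`. [folklore] -/
theorem sum_abs_smul {B : ℝ} (hB : 0 < B) (u : ι → ℝ) : ∑ j, |(B • u) j| = B * ∑ j, |u j| := by
  rw [Finset.mul_sum]
  refine Finset.sum_congr rfl fun j _ => ?_
  rw [Pi.smul_apply, smul_eq_mul, abs_mul, abs_of_pos hB]

/-- ℓ² letter: `(Bu)·(Bu) = B²(u·u)`. [folklore] -/
theorem smul_dotProduct_smul_self (B : ℝ) (u : ι → ℝ) : (B • u) ⬝ᵥ (B • u) = B ^ 2 * (u ⬝ᵥ u) := by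
  rw [smul_dotProduct, dotProduct_smul, smul_eq_mul, smul_eq_mul]
  ring

/-! ## §2 The master estimates for frames of any slot norm -/

/-- ★★★ **GENERIC-REGION DRIVING ESTIMATE, frames of slot norm `≤ B`.**  Verbatim ✓`generic_drive_lower` with `‖τ_j(w)‖ ≤ B` (`0 < B`)
in place of `≤ 1`; the price is `K ↦ K·B³` in the smallness hypothesis and the error terms:
`(1 − η − (3KB³#ι^{3/2}|u| + λ⋆/2 + 4(KB³)²#ι³|u|²/(ηλ⋆))/κ)·F₀(P) ≤ ½gᵀ(H+λ⋆)⁻¹g`.  (For `fixFrame`: `B = √2`.) [folklore] -/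
theorem generic_drive_lower_of_norm_le {τ : ι → ((Fin (2 * L - 1 + 1) × Edge 3 L) ⊕ Site 3 L) → Matrix (Fin 2) (Fin 2) ℂ} (hτ : ∀ j w, (τ j w)ᴴ = -τ j w) (hτ0 : ∀ j w, (τ j w).trace = 0)
    {B : ℝ} (hB : 0 < B) (hτn : ∀ j w, ‖τ j w‖ ≤ B) [DecidableEq ι] (u : ι → ℝ) (P : ((Fin (2 * L - 1 + 1) → GaugeConfig 3 L SU2) × (Site 3 L → SU2)))
    (hp : ringDeficit L (fun _ => false) (P * multiCurve (dirOf τ u) (dirOf_conjTranspose hτ u) (dirOf_trace hτ0 u) 1) = 0)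
    {K κ lam η : ℝ} (hK : 0 ≤ K) (hκ : 0 < κ) (hlam : 0 < lam) (hη : 0 < η) (hη1 : η < 1)
    (hK3 : ∀ (Y₁ Y₂ Y₃ : ((Fin (2 * L - 1 + 1) × Edge 3 L) ⊕ Site 3 L) → Matrix (Fin 2) (Fin 2) ℂ) (b₁ b₂ b₃ : ℝ), 0 ≤ b₁ → 0 ≤ b₂ → 0 ≤ b₃ →
      (∀ w, ‖Y₁ w‖ ≤ b₁) → (∀ w, ‖Y₂ w‖ ≤ b₂) → (∀ w, ‖Y₃ w‖ ≤ b₃) → ∀ Q : ((Fin (2 * L - 1 + 1) → GaugeConfig 3 L SU2) × (Site 3 L → SU2)),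
      |frameD Y₁ (frameD Y₂ (frameD Y₃ (ringPoly L))) (ringCoord L Q)| ≤ K * b₁ * b₂ * b₃)
    (hqg : κ * (u ⬝ᵥ u) ≤ ringDeficit L (fun _ => false) P)
    (hsmall : K * B ^ 3 * (∑ j, |u j|) * Fintype.card ι ≤ lam / 2) :
    (1 - η - (3 * (K * B ^ 3) * ((Fintype.card ι : ℝ) * Real.sqrt (Fintype.card ι)) * Real.sqrt (u ⬝ᵥ u) + lam / 2 +
        4 * (K * B ^ 3) ^ 2 * (Fintype.card ι : ℝ) ^ 3 * (u ⬝ᵥ u) / (η * lam)) / κ) * ringDeficit L (fun _ => false) P ≤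
      (1 / 2) * (frameGrad (L := L) τ (ringCoord L P) ⬝ᵥ
        ((frameHess (L := L) τ (ringCoord L P) + lam • (1 : Matrix ι ι ℝ))⁻¹ *ᵥ frameGrad (L := L) τ (ringCoord L P))) := by
  classical
  -- the rescaled data
  set τ₁ : ι → ((Fin (2 * L - 1 + 1) × Edge 3 L) ⊕ Site 3 L) → Matrix (Fin 2) (Fin 2) ℂ := fun j => B⁻¹ • τ j with hτ₁def
  have hτ₁ : ∀ j w, (τ₁ j w)ᴴ = -τ₁ j w := fun j w => smul_frame_conjTranspose hτ B⁻¹ j w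
  have hτ₁0 : ∀ j w, (τ₁ j w).trace = 0 := fun j w => smul_frame_trace hτ0 B⁻¹ j w
  have hτ₁n : ∀ j w, ‖τ₁ j w‖ ≤ 1 := fun j w => norm_inv_smul_frame_le hB hτn j w
  set u₁ : ι → ℝ := B • u with hu₁def
  have hdir : dirOf τ₁ u₁ = dirOf τ u := dirOf_inv_smul_frame_smul hB.ne' τ u
  have hp₁ : ringDeficit L (fun _ => false) (P * multiCurve (dirOf τ₁ u₁) (dirOf_conjTranspose hτ₁ u₁) (dirOf_trace hτ₁0 u₁) 1) = 0 := by
    rw [multiCurve_congr hdir _ _ (dirOf_conjTranspose hτ u) (dirOf_trace hτ0 u)]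
    exact hp
  have hB2 : 0 < B ^ 2 := by positivity
  have hB3 : 0 < B ^ 3 := by positivity
  have huu : u₁ ⬝ᵥ u₁ = B ^ 2 * (u ⬝ᵥ u) := smul_dotProduct_smul_self B u
  have hl1 : ∑ j, |u₁ j| = B * ∑ j, |u j| := sum_abs_smul hB u
  have hqg₁ : κ / B ^ 2 * (u₁ ⬝ᵥ u₁) ≤ ringDeficit L (fun _ => false) P := by
    have h1 : κ / B ^ 2 * (B ^ 2 * (u ⬝ᵥ u)) = κ * (u ⬝ᵥ u) := by field_simp
    rw [huu, h1]
    exact hqg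
  have hsmall₁ : K * (∑ j, |u₁ j|) * Fintype.card ι ≤ lam / B ^ 2 / 2 := by
    rw [hl1, div_div, le_div_iff₀ (by positivity)]
    calc K * (B * ∑ j, |u j|) * (Fintype.card ι) * (B ^ 2 * 2) = (K * B ^ 3 * (∑ j, |u j|) * Fintype.card ι) * 2 := by ring
      _ ≤ lam / 2 * 2 := by nlinarith [hsmall]
      _ = lam := by ring
  have key := generic_drive_lower (L := L) hτ₁ hτ₁0 hτ₁n u₁ P hp₁ hK (div_pos hκ hB2) (div_pos hlam hB2) hη hη1 hK3 hqg₁ hsmall₁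
  -- the right-hand side is invariant
  have hg₁ : frameGrad (L := L) τ₁ (ringCoord L P) = B⁻¹ • frameGrad (L := L) τ (ringCoord L P) := frameGrad_smul_frame B⁻¹ τ _
  have hH₁ : frameHess (L := L) τ₁ (ringCoord L P) = (B⁻¹ * B⁻¹) • frameHess (L := L) τ (ringCoord L P) := frameHess_smul_frame B⁻¹ τ _
  have hBi : (B⁻¹ * B⁻¹) ≠ 0 := by positivity
  have hshift : frameHess (L := L) τ₁ (ringCoord L P) + (lam / B ^ 2) • (1 : Matrix ι ι ℝ) =
      (B⁻¹ * B⁻¹) • (frameHess (L := L) τ (ringCoord L P) + lam • (1 : Matrix ι ι ℝ)) := by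
    rw [hH₁, ← smul_shift_eq]
    congr 2
    field_simp
  have hrhs : frameGrad (L := L) τ₁ (ringCoord L P) ⬝ᵥ ((frameHess (L := L) τ₁ (ringCoord L P) + (lam / B ^ 2) • (1 : Matrix ι ι ℝ))⁻¹ *ᵥ
      frameGrad (L := L) τ₁ (ringCoord L P)) = frameGrad (L := L) τ (ringCoord L P) ⬝ᵥ
        ((frameHess (L := L) τ (ringCoord L P) + lam • (1 : Matrix ι ι ℝ))⁻¹ *ᵥ frameGrad (L := L) τ (ringCoord L P)) := by
    rw [hshift, inv_smul_of_ne_zero hBi, hg₁, smul_mulVec, mulVec_smul, smul_dotProduct, dotProduct_smul, dotProduct_smul,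
      smul_eq_mul, smul_eq_mul, smul_eq_mul]
    field_simp
  rw [hrhs] at key
  -- the left-hand side coefficient is the same
  have hcoef : (1 - η - (3 * K * ((Fintype.card ι : ℝ) * Real.sqrt (Fintype.card ι)) * Real.sqrt (u₁ ⬝ᵥ u₁) + lam / B ^ 2 / 2 +
        4 * K ^ 2 * (Fintype.card ι : ℝ) ^ 3 * (u₁ ⬝ᵥ u₁) / (η * (lam / B ^ 2))) / (κ / B ^ 2)) =
      (1 - η - (3 * (K * B ^ 3) * ((Fintype.card ι : ℝ) * Real.sqrt (Fintype.card ι)) * Real.sqrt (u ⬝ᵥ u) + lam / 2 +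
        4 * (K * B ^ 3) ^ 2 * (Fintype.card ι : ℝ) ^ 3 * (u ⬝ᵥ u) / (η * lam)) / κ) := by
    have hsq : Real.sqrt (u₁ ⬝ᵥ u₁) = B * Real.sqrt (u ⬝ᵥ u) := by
      rw [huu, Real.sqrt_mul (sq_nonneg _), Real.sqrt_sq hB.le]
    rw [hsq, huu]
    field_simp
  rw [hcoef] at key
  exact key

/-- ★★★ **GENERIC-REGION DIVERGENCE ESTIMATE, frames of slot norm `≤ B`.**  Verbatim ✓`generic_divergence_upper` with `‖τ_j(w)‖ ≤ B`
(`0 < B`) in place of `≤ 1`; the price is `K ↦ K·B³` (the kernel family `k_a`, the matrices `B_i` and their bound `b` are unchanged):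
`½tr(A⁻¹H) − ½Σ_i(A⁻¹B_iA⁻¹g)_i ≤ ½(#ι − m) + ½·m·s/(s+λ⋆) + ½·#ι·(b/(λ⋆/2))·√(3((1+λ⋆²/(λ⋆/2)²)|u|² + M²|u|⁴/(λ⋆/2)²))` with
`s = KB³·ℓ·#ι`, `M = 2KB³#ι^{3/2}`.  (For `fixFrame`: `B = √2`.) [folklore] -/
theorem generic_divergence_upper_of_norm_le {τ : ι → ((Fin (2 * L - 1 + 1) × Edge 3 L) ⊕ Site 3 L) → Matrix (Fin 2) (Fin 2) ℂ} (hτ : ∀ j w, (τ j w)ᴴ = -τ j w)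
    (hτ0 : ∀ j w, (τ j w).trace = 0) {B : ℝ} (hB : 0 < B) (hτn : ∀ j w, ‖τ j w‖ ≤ B) [DecidableEq ι] (u : ι → ℝ) (P : ((Fin (2 * L - 1 + 1) → GaugeConfig 3 L SU2) × (Site 3 L → SU2)))
    (hp : ringDeficit L (fun _ => false) (P * multiCurve (dirOf τ u) (dirOf_conjTranspose hτ u) (dirOf_trace hτ0 u) 1) = 0)
    {K lam : ℝ} (hK : 0 ≤ K) (hlam : 0 < lam)
    (hK3 : ∀ (Y₁ Y₂ Y₃ : ((Fin (2 * L - 1 + 1) × Edge 3 L) ⊕ Site 3 L) → Matrix (Fin 2) (Fin 2) ℂ) (b₁ b₂ b₃ : ℝ), 0 ≤ b₁ → 0 ≤ b₂ → 0 ≤ b₃ →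
      (∀ w, ‖Y₁ w‖ ≤ b₁) → (∀ w, ‖Y₂ w‖ ≤ b₂) → (∀ w, ‖Y₃ w‖ ≤ b₃) → ∀ Q : ((Fin (2 * L - 1 + 1) → GaugeConfig 3 L SU2) × (Site 3 L → SU2)),
      |frameD Y₁ (frameD Y₂ (frameD Y₃ (ringPoly L))) (ringCoord L Q)| ≤ K * b₁ * b₂ * b₃)
    (hsmall : K * B ^ 3 * (∑ j, |u j|) * Fintype.card ι ≤ lam / 2)
    {m : ℕ} (k : Fin m → ι → ℝ) (hon : ∀ a a', k a ⬝ᵥ k a' = if a = a' then 1 else 0)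
    (hker : ∀ a, frameHessRaw (L := L) τ
      (ringCoord L (P * multiCurve (dirOf τ u) (dirOf_conjTranspose hτ u) (dirOf_trace hτ0 u) 1)) *ᵥ k a = 0)
    (Bm : ι → Matrix ι ι ℝ) {b : ℝ} (hb : 0 ≤ b) (hBm : ∀ i v, (Bm i *ᵥ v) ⬝ᵥ (Bm i *ᵥ v) ≤ b ^ 2 * (v ⬝ᵥ v)) :
    (1 / 2) * Matrix.trace ((frameHess (L := L) τ (ringCoord L P) + lam • (1 : Matrix ι ι ℝ))⁻¹ * frameHess (L := L) τ (ringCoord L P)) -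
        (1 / 2) * ∑ i, ((frameHess (L := L) τ (ringCoord L P) + lam • (1 : Matrix ι ι ℝ))⁻¹ *ᵥ
          (Bm i *ᵥ ((frameHess (L := L) τ (ringCoord L P) + lam • (1 : Matrix ι ι ℝ))⁻¹ *ᵥ frameGrad (L := L) τ (ringCoord L P)))) i ≤
      (1 / 2) * ((Fintype.card ι : ℝ) - m) +
        (1 / 2) * (m * ((K * B ^ 3 * (∑ j, |u j|) * Fintype.card ι) / (K * B ^ 3 * (∑ j, |u j|) * Fintype.card ι + lam))) +
        (1 / 2) * ((Fintype.card ι : ℝ) * (b / (lam / 2)) *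
          Real.sqrt (3 * ((1 + lam ^ 2 / (lam / 2) ^ 2) * (u ⬝ᵥ u) +
            (2 * (K * B ^ 3) * (Fintype.card ι : ℝ) * Real.sqrt (Fintype.card ι)) ^ 2 * (u ⬝ᵥ u) ^ 2 / (lam / 2) ^ 2))) := by
  classical
  set τ₁ : ι → ((Fin (2 * L - 1 + 1) × Edge 3 L) ⊕ Site 3 L) → Matrix (Fin 2) (Fin 2) ℂ := fun j => B⁻¹ • τ j with hτ₁def
  have hτ₁ : ∀ j w, (τ₁ j w)ᴴ = -τ₁ j w := fun j w => smul_frame_conjTranspose hτ B⁻¹ j w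
  have hτ₁0 : ∀ j w, (τ₁ j w).trace = 0 := fun j w => smul_frame_trace hτ0 B⁻¹ j w
  have hτ₁n : ∀ j w, ‖τ₁ j w‖ ≤ 1 := fun j w => norm_inv_smul_frame_le hB hτn j w
  set u₁ : ι → ℝ := B • u with hu₁def
  have hdir : dirOf τ₁ u₁ = dirOf τ u := dirOf_inv_smul_frame_smul hB.ne' τ u
  have hcurve : multiCurve (L := L) (dirOf τ₁ u₁) (dirOf_conjTranspose hτ₁ u₁) (dirOf_trace hτ₁0 u₁) 1 =
      multiCurve (L := L) (dirOf τ u) (dirOf_conjTranspose hτ u) (dirOf_trace hτ0 u) 1 := multiCurve_congr hdir _ _ _ _ 1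
  have hp₁ : ringDeficit L (fun _ => false) (P * multiCurve (dirOf τ₁ u₁) (dirOf_conjTranspose hτ₁ u₁) (dirOf_trace hτ₁0 u₁) 1) = 0 := by
    rw [hcurve]; exact hp
  have hB2 : 0 < B ^ 2 := by positivity
  have hB3 : 0 < B ^ 3 := by positivity
  have huu : u₁ ⬝ᵥ u₁ = B ^ 2 * (u ⬝ᵥ u) := smul_dotProduct_smul_self B u
  have hl1 : ∑ j, |u₁ j| = B * ∑ j, |u j| := sum_abs_smul hB u
  have hsmall₁ : K * (∑ j, |u₁ j|) * Fintype.card ι ≤ lam / B ^ 2 / 2 := by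
    rw [hl1, div_div, le_div_iff₀ (by positivity)]
    calc K * (B * ∑ j, |u j|) * (Fintype.card ι) * (B ^ 2 * 2) = (K * B ^ 3 * (∑ j, |u j|) * Fintype.card ι) * 2 := by ring
      _ ≤ lam / 2 * 2 := by nlinarith [hsmall]
      _ = lam := by ring
  -- kernel family: the raw Hessian only rescales
  have hker₁ : ∀ a, frameHessRaw (L := L) τ₁
      (ringCoord L (P * multiCurve (dirOf τ₁ u₁) (dirOf_conjTranspose hτ₁ u₁) (dirOf_trace hτ₁0 u₁) 1)) *ᵥ k a = 0 := by
    intro a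
    rw [hcurve, show τ₁ = fun j => B⁻¹ • τ j from rfl, frameHessRaw_smul_frame, smul_mulVec, hker a, smul_zero]
  -- the matrices `B⁻³ B_i`
  set Bm₁ : ι → Matrix ι ι ℝ := fun i => (B ^ 3)⁻¹ • Bm i with hBm₁def
  have hb₁ : 0 ≤ b / B ^ 3 := div_nonneg hb hB3.le
  have hBm₁ : ∀ i v, (Bm₁ i *ᵥ v) ⬝ᵥ (Bm₁ i *ᵥ v) ≤ (b / B ^ 3) ^ 2 * (v ⬝ᵥ v) := by
    intro i v
    have h1 : Bm₁ i *ᵥ v = (B ^ 3)⁻¹ • (Bm i *ᵥ v) := by simp only [hBm₁def, smul_mulVec]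
    rw [h1, smul_dotProduct, dotProduct_smul, smul_eq_mul, smul_eq_mul]
    calc (B ^ 3)⁻¹ * ((B ^ 3)⁻¹ * ((Bm i *ᵥ v) ⬝ᵥ (Bm i *ᵥ v))) = ((B ^ 3) ^ 2)⁻¹ * ((Bm i *ᵥ v) ⬝ᵥ (Bm i *ᵥ v)) := by ring
      _ ≤ ((B ^ 3) ^ 2)⁻¹ * (b ^ 2 * (v ⬝ᵥ v)) := mul_le_mul_of_nonneg_left (hBm i v) (by positivity)
      _ = (b / B ^ 3) ^ 2 * (v ⬝ᵥ v) := by rw [div_pow]; ring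
  have key := generic_divergence_upper (L := L) hτ₁ hτ₁0 hτ₁n u₁ P hp₁ hK (div_pos hlam hB2) hK3 hsmall₁ k hon hker₁ Bm₁ hb₁ hBm₁
  -- the left-hand side is invariant
  have hg₁ : frameGrad (L := L) τ₁ (ringCoord L P) = B⁻¹ • frameGrad (L := L) τ (ringCoord L P) := frameGrad_smul_frame B⁻¹ τ _
  have hH₁ : frameHess (L := L) τ₁ (ringCoord L P) = (B⁻¹ * B⁻¹) • frameHess (L := L) τ (ringCoord L P) := frameHess_smul_frame B⁻¹ τ _
  have hBi : (B⁻¹ * B⁻¹) ≠ 0 := by positivity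
  have hshift : frameHess (L := L) τ₁ (ringCoord L P) + (lam / B ^ 2) • (1 : Matrix ι ι ℝ) =
      (B⁻¹ * B⁻¹) • (frameHess (L := L) τ (ringCoord L P) + lam • (1 : Matrix ι ι ℝ)) := by
    rw [hH₁, ← smul_shift_eq]
    congr 2
    field_simp
  set A := frameHess (L := L) τ (ringCoord L P) + lam • (1 : Matrix ι ι ℝ) with hAdef
  set g := frameGrad (L := L) τ (ringCoord L P) with hgdef
  set H := frameHess (L := L) τ (ringCoord L P) with hHdef
  have htr : Matrix.trace ((frameHess (L := L) τ₁ (ringCoord L P) + (lam / B ^ 2) • (1 : Matrix ι ι ℝ))⁻¹ * frameHess (L := L) τ₁ (ringCoord L P)) =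
      Matrix.trace (A⁻¹ * H) := by
    rw [hshift, inv_smul_of_ne_zero hBi, hH₁, Matrix.smul_mul, Matrix.mul_smul, smul_smul, Matrix.trace_smul, smul_eq_mul]
    field_simp
  have hsum : ∑ i, ((frameHess (L := L) τ₁ (ringCoord L P) + (lam / B ^ 2) • (1 : Matrix ι ι ℝ))⁻¹ *ᵥ
      (Bm₁ i *ᵥ ((frameHess (L := L) τ₁ (ringCoord L P) + (lam / B ^ 2) • (1 : Matrix ι ι ℝ))⁻¹ *ᵥ frameGrad (L := L) τ₁ (ringCoord L P)))) i =
      ∑ i, (A⁻¹ *ᵥ (Bm i *ᵥ (A⁻¹ *ᵥ g))) i := by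
    refine Finset.sum_congr rfl fun i _ => ?_
    rw [hshift, inv_smul_of_ne_zero hBi, hg₁]
    simp only [hBm₁def, smul_mulVec, mulVec_smul, smul_smul, Pi.smul_apply, smul_eq_mul]
    field_simp
  rw [htr, hsum] at key
  -- the right-hand side is the same
  have hsq5 : Real.sqrt (3 * ((1 + (lam / B ^ 2) ^ 2 / (lam / B ^ 2 / 2) ^ 2) * (u₁ ⬝ᵥ u₁) +
      (2 * K * (Fintype.card ι : ℝ) * Real.sqrt (Fintype.card ι)) ^ 2 * (u₁ ⬝ᵥ u₁) ^ 2 / (lam / B ^ 2 / 2) ^ 2)) =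
      B * Real.sqrt (3 * ((1 + lam ^ 2 / (lam / 2) ^ 2) * (u ⬝ᵥ u) +
        (2 * (K * B ^ 3) * (Fintype.card ι : ℝ) * Real.sqrt (Fintype.card ι)) ^ 2 * (u ⬝ᵥ u) ^ 2 / (lam / 2) ^ 2)) := by
    have hin : 3 * ((1 + (lam / B ^ 2) ^ 2 / (lam / B ^ 2 / 2) ^ 2) * (u₁ ⬝ᵥ u₁) +
        (2 * K * (Fintype.card ι : ℝ) * Real.sqrt (Fintype.card ι)) ^ 2 * (u₁ ⬝ᵥ u₁) ^ 2 / (lam / B ^ 2 / 2) ^ 2) =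
        B ^ 2 * (3 * ((1 + lam ^ 2 / (lam / 2) ^ 2) * (u ⬝ᵥ u) +
          (2 * (K * B ^ 3) * (Fintype.card ι : ℝ) * Real.sqrt (Fintype.card ι)) ^ 2 * (u ⬝ᵥ u) ^ 2 / (lam / 2) ^ 2)) := by
      rw [huu]
      field_simp
    rw [hin, Real.sqrt_mul (sq_nonneg _), Real.sqrt_sq hB.le]
  have hrhs : (1 / 2) * ((Fintype.card ι : ℝ) - m) +
        (1 / 2) * (m * ((K * (∑ j, |u₁ j|) * Fintype.card ι) / (K * (∑ j, |u₁ j|) * Fintype.card ι + lam / B ^ 2))) +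
        (1 / 2) * ((Fintype.card ι : ℝ) * ((b / B ^ 3) / (lam / B ^ 2 / 2)) *
          Real.sqrt (3 * ((1 + (lam / B ^ 2) ^ 2 / (lam / B ^ 2 / 2) ^ 2) * (u₁ ⬝ᵥ u₁) +
            (2 * K * (Fintype.card ι : ℝ) * Real.sqrt (Fintype.card ι)) ^ 2 * (u₁ ⬝ᵥ u₁) ^ 2 / (lam / B ^ 2 / 2) ^ 2))) =
      (1 / 2) * ((Fintype.card ι : ℝ) - m) +
        (1 / 2) * (m * ((K * B ^ 3 * (∑ j, |u j|) * Fintype.card ι) / (K * B ^ 3 * (∑ j, |u j|) * Fintype.card ι + lam))) +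
        (1 / 2) * ((Fintype.card ι : ℝ) * (b / (lam / 2)) *
          Real.sqrt (3 * ((1 + lam ^ 2 / (lam / 2) ^ 2) * (u ⬝ᵥ u) +
            (2 * (K * B ^ 3) * (Fintype.card ι : ℝ) * Real.sqrt (Fintype.card ι)) ^ 2 * (u ⬝ᵥ u) ^ 2 / (lam / 2) ^ 2))) := by
    rw [hsq5, hl1]
    have hfrac : (K * (B * ∑ j, |u j|) * Fintype.card ι) / (K * (B * ∑ j, |u j|) * Fintype.card ι + lam / B ^ 2) =
        (K * B ^ 3 * (∑ j, |u j|) * Fintype.card ι) / (K * B ^ 3 * (∑ j, |u j|) * Fintype.card ι + lam) := by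
      rw [div_eq_div_iff ?_ ?_]
      · field_simp
      · have : 0 ≤ K * (B * ∑ j, |u j|) * Fintype.card ι := by
          have := Finset.sum_nonneg fun j (_ : j ∈ Finset.univ) => abs_nonneg (u j)
          positivity
        positivity
      · have : 0 ≤ K * B ^ 3 * (∑ j, |u j|) * Fintype.card ι := by
          have := Finset.sum_nonneg fun j (_ : j ∈ Finset.univ) => abs_nonneg (u j)
          positivity
        positivity
    rw [hfrac]
    congr 2
    have hbb : (b / B ^ 3) / (lam / B ^ 2 / 2) * (B * Real.sqrt (3 * ((1 + lam ^ 2 / (lam / 2) ^ 2) * (u ⬝ᵥ u) +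
        (2 * (K * B ^ 3) * (Fintype.card ι : ℝ) * Real.sqrt (Fintype.card ι)) ^ 2 * (u ⬝ᵥ u) ^ 2 / (lam / 2) ^ 2))) =
        b / (lam / 2) * Real.sqrt (3 * ((1 + lam ^ 2 / (lam / 2) ^ 2) * (u ⬝ᵥ u) +
        (2 * (K * B ^ 3) * (Fintype.card ι : ℝ) * Real.sqrt (Fintype.card ι)) ^ 2 * (u ⬝ᵥ u) ^ 2 / (lam / 2) ^ 2)) := by
      field_simp
    rw [mul_assoc, hbb, ← mul_assoc]
  rw [hrhs] at key
  exact key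

end Summit.QuantumFields.YangMills.Theorems.VirialFluxGap.FrameHessian

end
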